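import Summits.AnomalousDissipation.AnomalousDissipation.Theses.MomentParity
import Literature.Analysis.FluidPDE.GalerkinFlow

/-!
# Sketch — crux-ideate stmt-AnomalousDissipation-14283 (GalerkinInvariantLoud), round 1, ideator 3

First lemmas of two crux ideas (signatures elaborate; proofs are NOT part of this stage):

* `compact-menu-usc`: `GILBody` (the crux body at one `(ν, N, f, E, ε, R, μ)`, verbatim),
  `gil_iff_body` (readback, `Iff.rfl`), `loud_closed_in_force` (u.s.c. of loud Galerkin-invariant
  measures under convergence of the force at FIXED `(ν, N)`), `FiniteMenuGIL`, `gil_of_finiteMenu`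
  (finite-intersection assembly over a compact smooth force box).
* `rayleigh-floor-one-trajectory`: `RatioFloor` (one clause instead of two), `gil_of_ratioFloor`,
  `ratioFloor_of_gil`, `OneTrajectoryTaylor` (one Galerkin trajectory with a time-mean
  dissipation/energy ratio floor), `ratioFloor_of_oneTrajectory` (Krylov–Bogoliubov).
-/

namespace Summit.AnomalousDissipation.AnomalousDissipation.Cruxes.GalerkinInvariantLoud.Ideator3

open MeasureTheory Filter Topology Set
open scoped ENNReal
open Literature.Analysis.FunctionSpaces Literature.Analysis.FluidPDE
open Summit.AnomalousDissipation.AnomalousDissipation.Theses.MomentParity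

/-- The test-field admissibility clause of the crux at level `N` (smooth, solenoidal, mean-zero,
band-limited to `0 < |k| ≤ N`). -/
def IsBandTest (N : ℕ) (g : UnitAddTorus (Fin 3) → EuclideanSpace ℝ (Fin 3)) : Prop :=
  Torus.IsSmooth g ∧ Torus.IsDivFree g ∧ Torus.HasZeroMean g ∧
    ∀ k ∉ (Torus.freqBall N).erase (0 : Fin 3 → ℤ),
      UnitAddTorus.mFourierCoeff (EuclideanSpace.complexify ∘ g) k = 0

/-- The carried/supported/stationary clauses of `GalerkinInvariantLoud` at one `(ν, N, f, R, μ)`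
(no budgets). -/
def IsLevelInvariant (ν : ℝ) (N : ℕ) (f : UnitAddTorus (Fin 3) → EuclideanSpace ℝ (Fin 3)) (R : ℝ)
    (μ : Measure (Torus.energySpace (Fin 3))) : Prop :=
  IsProbabilityMeasure μ ∧
  (∀ᵐ (u : Torus.energySpace (Fin 3)) ∂μ, (∀ k ∉ (Torus.freqBall N).erase (0 : Fin 3 → ℤ),
    UnitAddTorus.mFourierCoeff (EuclideanSpace.complexify ∘
      (u.1 : UnitAddTorus (Fin 3) → EuclideanSpace ℝ (Fin 3))) k = 0)) ∧
  (∀ᵐ u ∂μ, ‖u‖ ≤ R) ∧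
  (∀ (m : ℕ) (g : Fin m → UnitAddTorus (Fin 3) → EuclideanSpace ℝ (Fin 3))
      (P : MvPolynomial (Fin m) ℝ), (∀ i, IsBandTest N (g i)) →
    Integrable (fun u => Torus.nsGeneratorPairing ν f u (fun x => ∑ i : Fin m,
      (MvPolynomial.eval (fun j => Torus.pairing u.1 (g j)) (MvPolynomial.pderiv i P)) • g i x)) μ ∧
    ∫ u, Torus.nsGeneratorPairing ν f u (fun x => ∑ i : Fin m,
      (MvPolynomial.eval (fun j => Torus.pairing u.1 (g j)) (MvPolynomial.pderiv i P)) • g i x) ∂μ = 0)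

/-- The full crux body at one `(ν, N, f, E, ε, R, μ)`: invariant clauses plus the two budgets. -/
def GILBody (ν : ℝ) (N : ℕ) (f : UnitAddTorus (Fin 3) → EuclideanSpace ℝ (Fin 3)) (E ε R : ℝ)
    (μ : Measure (Torus.energySpace (Fin 3))) : Prop :=
  IsLevelInvariant ν N f R μ ∧ Torus.ensembleEnergy μ ≤ E ∧ ε ≤ Torus.ensembleDissipation ν μ

/-- Admissible steady forces. -/
def IsForce (f : UnitAddTorus (Fin 3) → EuclideanSpace ℝ (Fin 3)) : Prop :=
  Torus.IsSmooth f ∧ Torus.IsDivFree f ∧ Torus.HasZeroMean f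

/-- READBACK: the crux is `∃ f force, ∃ ν E ε, …, ∀ j ∃ R ∃ᶠ N ∃ μ, GILBody`. -/
theorem gil_iff_body :
    GalerkinInvariantLoud ↔
      ∃ f : UnitAddTorus (Fin 3) → EuclideanSpace ℝ (Fin 3), Torus.IsSmooth f ∧ Torus.IsDivFree f ∧
        Torus.HasZeroMean f ∧ ∃ (ν : ℕ → ℝ) (E ε : ℝ), (∀ j, 0 < ν j) ∧ Tendsto ν atTop (nhds 0) ∧
        0 < ε ∧ ∀ j : ℕ, ∃ R : ℝ, ∃ᶠ N in atTop, ∃ μ : Measure (Torus.energySpace (Fin 3)),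
          IsProbabilityMeasure μ ∧
          (∀ᵐ (u : Torus.energySpace (Fin 3)) ∂μ, (∀ k ∉ (Torus.freqBall N).erase (0 : Fin 3 → ℤ),
            UnitAddTorus.mFourierCoeff (EuclideanSpace.complexify ∘
              (u.1 : UnitAddTorus (Fin 3) → EuclideanSpace ℝ (Fin 3))) k = 0)) ∧
          (∀ᵐ u ∂μ, ‖u‖ ≤ R) ∧
          (∀ (m : ℕ) (g : Fin m → UnitAddTorus (Fin 3) → EuclideanSpace ℝ (Fin 3))
              (P : MvPolynomial (Fin m) ℝ), (∀ i, IsBandTest N (g i)) →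
            Integrable (fun u => Torus.nsGeneratorPairing (ν j) f u (fun x => ∑ i : Fin m,
              (MvPolynomial.eval (fun j => Torus.pairing u.1 (g j)) (MvPolynomial.pderiv i P)) •
                g i x)) μ ∧
            ∫ u, Torus.nsGeneratorPairing (ν j) f u (fun x => ∑ i : Fin m,
              (MvPolynomial.eval (fun j => Torus.pairing u.1 (g j)) (MvPolynomial.pderiv i P)) •
                g i x) ∂μ = 0) ∧
          Torus.ensembleEnergy μ ≤ E ∧ ε ≤ Torus.ensembleDissipation (ν j) μ :=
  Iff.rfl

/-- The same readback through `GILBody`. -/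
theorem gil_iff_gilBody :
    GalerkinInvariantLoud ↔
      ∃ f : UnitAddTorus (Fin 3) → EuclideanSpace ℝ (Fin 3), IsForce f ∧
        ∃ (ν : ℕ → ℝ) (E ε : ℝ), (∀ j, 0 < ν j) ∧ Tendsto ν atTop (nhds 0) ∧ 0 < ε ∧
          ∀ j : ℕ, ∃ R : ℝ, ∃ᶠ N in atTop, ∃ μ, GILBody (ν j) N f E ε R μ := by
  simp only [gil_iff_body, GILBody, IsLevelInvariant, IsForce, and_assoc]

/-! ## Idea `compact-menu-usc` -/

/-- **Closedness of loudness in the force at fixed `(ν, N)` (u.s.c. of Galerkin-invariant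
measures).** If admissible forces `fk k → f` in `L²(T³)` and each `fk k` carries a measure with
the crux body at `(ν, N, E, ε, R)`, then so does `f`, with the SAME `(ν, N, E, ε, R)`.
Proof plan (M): the measures live on the compact set `P_N H ∩ B_R` of a finite-dimensional space
(Prokhorov/Riesz ⇒ a weak-* limit point `μ`); the level-`N` Galerkin generator pairing against a
fixed polynomial cylindrical test is a polynomial in finitely many coordinates of `u` whose
coefficients depend continuously (affinely) on `P_N f`, so stationarity passes to the limit;
`ensembleEnergy` and `ensembleDissipation` are continuous bounded functions on that compact set
(Bernstein: enstrophy `≤ 4π²N²R²`), so both budgets pass WITH EQUALITY. No estimate uniform in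
`ν` or `N` is involved. -/
theorem loud_closed_in_force (ν : ℝ) (N : ℕ) (E ε R : ℝ)
    (fk : ℕ → UnitAddTorus (Fin 3) → EuclideanSpace ℝ (Fin 3))
    (f : UnitAddTorus (Fin 3) → EuclideanSpace ℝ (Fin 3))
    (hν : 0 < ν) (hfk : ∀ k, IsForce (fk k)) (hf : IsForce f)
    (hconv : Tendsto (fun k => ∫ x, ‖fk k x - f x‖ ^ 2) atTop (nhds 0))
    (hloud : ∀ k, ∃ μ, GILBody ν N (fk k) E ε R μ) :
    ∃ μ, GILBody ν N f E ε R μ := by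
  sorry

/-- **The finite-menu form of the crux.** A compact `C^∞` force box — Fourier coefficients
dominated by a rapidly decreasing profile `a` — budgets `E, ε`, viscosities `ν_j → 0`, radii
`R_j`, and levels `Nm j i → ∞` (as `i → ∞`), such that for every FINITE menu `S` of pairs `(j, i)`
ONE box force (allowed to depend on `S`) carries a loud bounded Galerkin-invariant measure at
every `(ν_j, Nm j i) ∈ S`. -/
def FiniteMenuGIL : Prop :=
  ∃ a : (Fin 3 → ℤ) → ℝ, (∀ s : ℕ, Summable fun k : Fin 3 → ℤ => (1 + Torus.freqNormSq k) ^ s * a k) ∧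
    ∃ (ν : ℕ → ℝ) (Nm : ℕ → ℕ → ℕ) (E ε : ℝ) (R : ℕ → ℝ), (∀ j, 0 < ν j) ∧
      Tendsto ν atTop (nhds 0) ∧ 0 < ε ∧ (∀ j, Tendsto (Nm j) atTop atTop) ∧
      ∀ S : Finset (ℕ × ℕ), ∃ f : UnitAddTorus (Fin 3) → EuclideanSpace ℝ (Fin 3), IsForce f ∧
        (∀ k, ‖UnitAddTorus.mFourierCoeff (EuclideanSpace.complexify ∘ f) k‖ ≤ a k) ∧
        ∀ p ∈ S, ∃ μ, GILBody (ν p.1) (Nm p.1 p.2) f E ε (R p.1) μ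

/-- **Finite-intersection assembly**: `FiniteMenuGIL → GalerkinInvariantLoud`. Plan (M, soft):
the box `{f : IsForce f ∧ |f̂(k)| ≤ a k}` is sequentially compact for `L²` (indeed `C^∞`)
convergence (dominated tails); `loud_closed_in_force` makes each
`C_{j,i} := {box forces loud-bounded at (ν_j, Nm j i)}` closed; every finite intersection is
non-empty by hypothesis, so a diagonal limit `f*` lies in all of them; `Nm j i → ∞` gives `∃ᶠ N`;
`f* ≠ 0` because `0 ∉ C_{j,i}` (`ε > 0`). -/
theorem gil_of_finiteMenu : FiniteMenuGIL → GalerkinInvariantLoud := by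
  sorry

/-! ## Idea `rayleigh-floor-one-trajectory` -/

/-- **The ratio form of the crux** (one clause instead of two): some level-`N` invariant measure
with dissipation ≥ `r ×` energy, `r > 0` uniform in `j`. -/
def RatioFloor : Prop :=
  ∃ f : UnitAddTorus (Fin 3) → EuclideanSpace ℝ (Fin 3), IsForce f ∧
    ∃ (ν : ℕ → ℝ) (r : ℝ), (∀ j, 0 < ν j) ∧ Tendsto ν atTop (nhds 0) ∧ 0 < r ∧
      ∀ j : ℕ, ∃ R : ℝ, ∃ᶠ N in atTop, ∃ μ, IsLevelInvariant (ν j) N f R μ ∧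
        r * Torus.ensembleEnergy μ ≤ Torus.ensembleDissipation (ν j) μ

/-- **Two clauses for free**: `RatioFloor → GalerkinInvariantLoud` with `E := ‖f‖₂²/r²` and
`ε := r · ‖f‖₂²/(4‖∇f‖_∞)` (for `j` large, then shift the sequence). Plan (M): for an invariant `μ`
of the crux's class, (1) the POWER IDENTITY `ν∫‖∇u‖²dμ = ∫(u,f)dμ` (test `|P_N u|²` written as a
sum of squares of band pairings; = refuter's `dissipation_eq`) and Cauchy–Schwarz give
`dissipation ≤ ‖f‖₂ · energy^{1/2}` (refuter's `eps_le_force`), hence `r·e ≤ ‖f‖√e`, i.e. the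
ENERGY CEILING `e ≤ ‖f‖²/r²`; (2) the f-TEST IDENTITY (linear test `(u, P_N f)`):
`‖P_N f‖² + ν(ū, ΔP_N f) + ∫(u⊗u : ∇P_N f)dμ = 0` gives the ENERGY FLOOR
`e ≥ ‖f‖²/(4‖∇f‖_∞)` once `ν√e‖ΔP_Nf‖ ≤ ‖f‖²/4` and `‖P_N f‖² ≥ ‖f‖²/2`, hence LOUDNESS
`dissipation ≥ r·e ≥ ε`. -/
theorem gil_of_ratioFloor : RatioFloor → GalerkinInvariantLoud := by
  sorry

/-- Converse bookkeeping: `GalerkinInvariantLoud → RatioFloor` with `r := ε / E` (`E > 0` because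
a loud measure has positive energy). -/
theorem ratioFloor_of_gil : GalerkinInvariantLoud → RatioFloor := by
  sorry

/-- **One trajectory per `(j, N)`**: a Galerkin mode `a` of order `N` whose orbit under the
Galerkin semiflow `Torus.galerkinFlow (ν j) f N` has time-mean dissipation-to-energy RATIO
bounded below, `liminf_T ν_j∫₀ᵀ‖∇u‖² / ∫₀ᵀ‖u‖² ≥ r` — no energy control, no pointwise floor,
no running-average uniformity; scale-free under Reynolds similarity. -/
def OneTrajectoryTaylor : Prop :=
  ∃ f : UnitAddTorus (Fin 3) → EuclideanSpace ℝ (Fin 3), IsForce f ∧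
    ∃ (ν : ℕ → ℝ) (r : ℝ), (∀ j, 0 < ν j) ∧ Tendsto ν atTop (nhds 0) ∧ 0 < r ∧
      ∀ j : ℕ, ∃ᶠ N in atTop, ∃ a : UnitAddTorus (Fin 3) → EuclideanSpace ℝ (Fin 3),
        IsGalerkinMode N a ∧ Torus.HasZeroMean a ∧
        r ≤ Filter.liminf (fun T : ℝ =>
          (ν j * (∫⁻ t in Ioo 0 T, Torus.eGradNormSq (Torus.galerkinFlow (ν j) f N t a)).toReal) /
            (∫ t in (0 : ℝ)..T, ∫ x, ‖Torus.galerkinFlow (ν j) f N t a x‖ ^ 2)) atTop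

/-- **Krylov–Bogoliubov step**: `OneTrajectoryTaylor → RatioFloor`. Plan (M/L): at fixed `(j, N)`
the orbit stays in the absorbing ball `‖u‖ ≤ R_j := ‖f‖₂/(4π²ν_j) + ‖a‖` (energy identity
`IsGalerkinMode.galerkinFlow_clauses`); the empirical measures `T⁻¹∫₀ᵀ δ_{u(t)} dt` on the compact
set `P_N H ∩ B_{R_j}` (pushed to `H`) have a weak-* limit point along a sequence `T_n → ∞` realising
the liminf; the limit is a probability measure, level-`N` carried, supported in `B_{R_j}`, invariant
under the semiflow hence stationary against every polynomial cylindrical band-limited test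
(chain rule along the flow + `T⁻¹(Φ(u(T)) − Φ(u(0))) → 0`), and — energy and enstrophy being
continuous on the compact set, with time-mean energy bounded below by the f-test floor —
`r · energy ≤ dissipation` passes to the limit as a ratio of limits. -/
theorem ratioFloor_of_oneTrajectory : OneTrajectoryTaylor → RatioFloor := by
  sorry

end Summit.AnomalousDissipation.AnomalousDissipation.Cruxes.GalerkinInvariantLoud.Ideator3
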